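import Mathlib
import Summits.NavierStokesRegularity.NavierStokesRegularity.Theorems.EulerZoomLiouvillePowerGaugeEulerLiouvilleFrozenVorticityMember
import HarnessLib

/-!
# Crux `EulerZoomLiouville.PowerGaugeEulerLiouville` (stmt-NavierStokesRegularity-19832), stub `stub_nonSelfSimilarRest`:
# SEPARABLE MEMBERS `u(t,x) = Λ(t) U(x)` ARE TRIVIAL UNLESS THE CLOCK IS RICCATI (`Λ' = kΛ²` in `𝒟'`)

Helper file (theorems only; `--supports stmt-NavierStokesRegularity-19832`; def-free).  Hand leafhand-ns-eulerzoomliouville-10 g4.  COMPLEMENTARY to hand 11 g0's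
`…SeparablePast` (`E`-gauge: separable pasts with NON-EVANESCENT modulation are trivial): here the EULER SYSTEM does the work and the modulation may be
evanescent (`|τ|^{−β}`, `β ≠ 1`, `e^{λτ}`, …); together the two files leave exactly the Riccati clocks.

THE STRATUM.  A class member with `u(t,x) = Λ(t) U(x)` for a.e. `(t,x) ∈ (−∞,T₁) × ℝ³` (`T₁ ≤ 0`), `Λ : ℝ → ℝ` continuous, `U : ℝ³ → ℝ³` ARBITRARY, whose clock
`Λ` is, for NO `k ∈ ℝ`, a distributional solution of the Riccati law `Λ' = kΛ²` on `(−∞,T₁)` — for every `k` some `θ ∈ C_c^∞((−∞,T₁))` has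
`∫ (θ'Λ + k θΛ²) ≠ 0` — is trivial (`Loc.ae_eq_zero_of_aeSeparableNonRiccatiPast`, binder `Birth.nonSelfSimilar_of_aeSeparableNonRiccatiPast`).
WHY.  Separation of variables in the momentum identity tested with `θ(t)η(x)`, `η` a curl pair (`AntiMember.momentum_tensor`, Fubini
`integral_prod_mul`): `(∫θ'Λ)·A_η + (∫θΛ²)·B_η = 0` with `A_η = ∫⟪U,η⟫`, `B_η = ∫⟪U, Dη[U]⟫`.  If `A_η ≠ 0` the clock solves `Λ' = (B_η/A_η)Λ²` in `𝒟'`,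
excluded; so `(∫θ'Λ)·A_η = 0` for all `θ, η`, i.e. `∫∫ θ'(t)⟪u, η⟫ = 0`: the weak vorticity is frozen and hand g3's `Loc.ae_eq_zero_of_frozenCurl` kills the member.
WHAT SURVIVES.  Exactly the Riccati clocks `Λ(t) = 1/(k(T* − t))` (`k ≠ 0`, `T* ≥ T₁`) — the stationary-profile collapse `u = (T*−t)^{−1} V(x)` (self-similar
ansatz with `γ = 0`), whose profile solves the damped steady Euler system `kV + V·∇V + ∇P = 0` — and `Λ` constant (steady, killed elsewhere).  Every other
separable time dependence (exponential `e^{λt}`, polynomial, oscillatory, any non-Riccati law) is dead, with no assumption on `U`.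

WHAT THIS IS NOT: not a proof of the stub or of the crux; nothing about Navier–Stokes. [folklore; MajdaBertozziCUP2002 §1.2]
-/

noncomputable section

-- flat `Theorems/<Route><Decl>…` files of one crux share the namespace of the crux (tree convention)
set_option linter.dupNamespace false

open MeasureTheory Set Filter Topology Metric Function TopologicalSpace
open scoped RealInnerProductSpace NNReal ENNReal ContDiff

namespace Summit.NavierStokesRegularity.NavierStokesRegularity.Theorems.PowerGaugeEulerLiouville

open Literature.Analysis Literature.Analysis.FunctionSpaces Literature.Analysis.FluidPDE

namespace Separable

variable {u : ℝ → EuclideanSpace ℝ (Fin 3) → EuclideanSpace ℝ (Fin 3)}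

/-- **SEPARATION OF VARIABLES IN THE MOMENTUM IDENTITY.**  For a distributional Euler pair on `(−∞,T₀) × ℝ³` with `u(t,x) = Λ(t)U(x)` a.e. on `(−∞,T₁) × ℝ³`,
`T₁ ≤ T₀`, `θ ∈ C_c^∞((−∞,T₁))` and a divergence-free test field `η`:
`(∫ θ'Λ)·∫⟪U, η⟫ + (∫ θΛ²)·∫⟪U, Dη[U]⟫ = 0` and `∫∫ θ'(t)⟪u, η⟫ = (∫ θ'Λ)·∫⟪U, η⟫`. [folklore] -/
theorem momentum_separated {p : ℝ → EuclideanSpace ℝ (Fin 3) → ℝ} {T₀ T₁ : ℝ} (hT : T₁ ≤ T₀)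
    (hdist : IsDistributionalNSSolutionOn (slab (EuclideanSpace ℝ (Fin 3)) (Iio T₀) isOpen_Iio) 0 0 u p)
    {Λ : ℝ → ℝ} {U : EuclideanSpace ℝ (Fin 3) → EuclideanSpace ℝ (Fin 3)}
    (hsep : ∀ᵐ z ∂(volume.restrict (Iio T₁ ×ˢ (univ : Set (EuclideanSpace ℝ (Fin 3))))), u z.1 z.2 = Λ z.1 • U z.2)
    {θ : ℝ → ℝ} (hθ : ContDiff ℝ ∞ θ) (hθc : HasCompactSupport θ) (hθT : tsupport θ ⊆ Iio T₁)
    {η : EuclideanSpace ℝ (Fin 3) → EuclideanSpace ℝ (Fin 3)} (hη : IsTestFunctionOn (⊤ : Opens (EuclideanSpace ℝ (Fin 3))) η)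
    (hdiv : ∀ x, VectorCalculus.divergence η x = 0) :
    (∫ t, deriv θ t * Λ t) * (∫ x, ⟪U x, η x⟫) + (∫ t, θ t * Λ t ^ 2) * (∫ x, ⟪U x, fderiv ℝ η x (U x)⟫) = 0 ∧
      ∫ z : ℝ × EuclideanSpace ℝ (Fin 3), deriv θ z.1 * ⟪u z.1 z.2, η z.2⟫ = (∫ t, deriv θ t * Λ t) * ∫ x, ⟪U x, η x⟫ := by
  have hθT₀ : tsupport θ ⊆ Iio T₀ := hθT.trans (Iio_subset_Iio hT)
  obtain ⟨hκ, hκc, hκT⟩ := AntiMember.deriv_cutoff_props hθ hθc hθT₀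
  have H1 := AntiMember.momentum_tensor hdist hθ hθc hθT₀ hη hdiv
  have hu : LocallyIntegrableOn (uncurry u) (Iio T₀ ×ˢ (univ : Set (EuclideanSpace ℝ (Fin 3)))) volume := by
    simpa only [coe_slab] using hdist.1
  have hum : AEStronglyMeasurable (uncurry u) (volume.restrict (Iio T₀ ×ˢ (univ : Set (EuclideanSpace ℝ (Fin 3))))) :=
    hu.aestronglyMeasurable
  have hu2 : LocallyIntegrableOn (fun z => ‖uncurry u z‖ ^ 2) (Iio T₀ ×ˢ (univ : Set (EuclideanSpace ℝ (Fin 3)))) volume := by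
    simpa only [coe_slab] using hdist.2.1
  have iA := AntiMember.integrable_mul_inner_field hu hκ hκc hκT hη.contDiff.continuous hη.hasCompactSupport
  have iB := AntiMember.integrable_mul_inner_fderiv_apply hum hu2 hθ.continuous hθc hθT₀ (hη.contDiff.of_le (by norm_cast))
    hη.hasCompactSupport
  -- the two summands, separated
  have hae : ∀ᵐ z ∂(volume : Measure (ℝ × EuclideanSpace ℝ (Fin 3))), z.1 < T₁ → u z.1 z.2 = Λ z.1 • U z.2 := by
    have h := ae_imp_of_ae_restrict hsep
    filter_upwards [h] with z hz hzT
    exact hz ⟨hzT, mem_univ _⟩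
  have eA : (fun z : ℝ × EuclideanSpace ℝ (Fin 3) => deriv θ z.1 * ⟪u z.1 z.2, η z.2⟫) =ᵐ[volume]
      fun z => (deriv θ z.1 * Λ z.1) * ⟪U z.2, η z.2⟫ := by
    filter_upwards [hae] with z hz
    by_cases hzT : z.1 < T₁
    · rw [hz hzT, inner_smul_left]; simp only [conj_trivial]; ring
    · rw [AntiMember.deriv_eq_zero_of_tsupport_subset_Iio hθT (not_lt.1 hzT)]; ring
  have eB : (fun z : ℝ × EuclideanSpace ℝ (Fin 3) => θ z.1 * ⟪u z.1 z.2, fderiv ℝ η z.2 (u z.1 z.2)⟫) =ᵐ[volume]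
      fun z => (θ z.1 * Λ z.1 ^ 2) * ⟪U z.2, fderiv ℝ η z.2 (U z.2)⟫ := by
    filter_upwards [hae] with z hz
    by_cases hzT : z.1 < T₁
    · rw [hz hzT, map_smul, inner_smul_left, inner_smul_right]; simp only [conj_trivial]; ring
    · rw [AntiMember.eq_zero_of_tsupport_subset_Iio hθT (not_lt.1 hzT)]; ring
  have hIA : ∫ z : ℝ × EuclideanSpace ℝ (Fin 3), deriv θ z.1 * ⟪u z.1 z.2, η z.2⟫ = (∫ t, deriv θ t * Λ t) * ∫ x, ⟪U x, η x⟫ := by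
    rw [integral_congr_ae eA, Measure.volume_eq_prod]
    exact integral_prod_mul (fun t => deriv θ t * Λ t) (fun x => ⟪U x, η x⟫)
  have hIB : ∫ z : ℝ × EuclideanSpace ℝ (Fin 3), θ z.1 * ⟪u z.1 z.2, fderiv ℝ η z.2 (u z.1 z.2)⟫ =
      (∫ t, θ t * Λ t ^ 2) * ∫ x, ⟪U x, fderiv ℝ η x (U x)⟫ := by
    rw [integral_congr_ae eB, Measure.volume_eq_prod]
    exact integral_prod_mul (fun t => θ t * Λ t ^ 2) (fun x => ⟪U x, fderiv ℝ η x (U x)⟫)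
  rw [integral_add iA iB, hIA, hIB] at H1
  exact ⟨H1, hIA⟩

end Separable

/-! ## Member level -/

/-- **SEPARABLE MEMBERS WITH A NON-RICCATI CLOCK ARE TRIVIAL** (member level, every `ρ > 0`, no assumption on the profile `U`).  Crux hypotheses verbatim, `T₁ ≤ 0`,
`u(t,x) = Λ(t) U(x)` for a.e. `(t,x) ∈ (−∞,T₁) × ℝ³` with `Λ` continuous, and for every `k ∈ ℝ` a test `θ ∈ C_c^∞((−∞,T₁))` with `∫ (θ'Λ + k θΛ²) ≠ 0`
(the clock solves no Riccati law `Λ' = kΛ²` in `𝒟'((−∞,T₁))`; `k = 0` excludes the constant clock).  Then `u = 0` a.e. on the slab. [folklore] -/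
theorem Loc.ae_eq_zero_of_aeSeparableNonRiccatiPast {ρ : ℝ} (hρ : 0 < ρ)
    {u : ℝ → EuclideanSpace ℝ (Fin 3) → EuclideanSpace ℝ (Fin 3)} {p : ℝ → EuclideanSpace ℝ (Fin 3) → ℝ}
    {H : ℝ → EuclideanSpace ℝ (Fin 3) → EuclideanSpace ℝ (Fin 3) →L[ℝ] EuclideanSpace ℝ (Fin 3)} {c : ℝ≥0}
    (hsw : IsSuitableWeakSolutionOn (slab (EuclideanSpace ℝ (Fin 3)) (Iio 0) isOpen_Iio) 0 0 u p)
    (hH : HasWeakSpatialGradientOn (slab (EuclideanSpace ℝ (Fin 3)) (Iio 0) isOpen_Iio) u H)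
    (hc : ∀ a : ℝ, 0 < a → ENNReal.ofReal (a ^ (2 * ρ)) * cknA a (0 : ℝ × EuclideanSpace ℝ (Fin 3)) u +
        ENNReal.ofReal (a ^ ρ) * cknE a (0 : ℝ × EuclideanSpace ℝ (Fin 3)) H +
        ENNReal.ofReal (a ^ (2 * ρ)) * cknD a (0 : ℝ × EuclideanSpace ℝ (Fin 3)) p ≤ (c : ℝ≥0∞))
    {T₁ : ℝ} (hT₁ : T₁ ≤ 0) {Λ : ℝ → ℝ} (hΛ : Continuous Λ) {U : EuclideanSpace ℝ (Fin 3) → EuclideanSpace ℝ (Fin 3)}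
    (hsep : ∀ᵐ z ∂(volume.restrict (Iio T₁ ×ˢ (univ : Set (EuclideanSpace ℝ (Fin 3))))), u z.1 z.2 = Λ z.1 • U z.2)
    (hclock : ∀ k : ℝ, ∃ θ : ℝ → ℝ, ContDiff ℝ ∞ θ ∧ HasCompactSupport θ ∧ tsupport θ ⊆ Iio T₁ ∧
      ∫ t, (deriv θ t * Λ t + k * (θ t * Λ t ^ 2)) ≠ 0) :
    uncurry u =ᵐ[volume.restrict (Iio (0 : ℝ) ×ˢ (univ : Set (EuclideanSpace ℝ (Fin 3))))] 0 := by
  have hdist := hsw.distributional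
  refine Loc.ae_eq_zero_of_frozenCurl hρ hsw hH hc hT₁ fun θ hθ hθc hθT g hg a c' => ?_
  have hη := isTestFunctionOn_curlPair hg a c'
  have hdiv := isDivFree_curlPair_of_contDiff (hg.contDiff.of_le (by norm_cast)) a c'
  obtain ⟨-, hIA⟩ := Separable.momentum_separated hT₁ hdist hsep hθ hθc hθT hη hdiv
  rw [hIA]
  by_cases hA0 : (∫ x, ⟪U x, fderiv ℝ g x a • c' - fderiv ℝ g x c' • a⟫) = 0
  · rw [hA0, mul_zero]
  · -- otherwise the clock would solve the Riccati law `Λ' = (B/A) Λ²` in `𝒟'`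
    exfalso
    obtain ⟨θ₀, hθ₀, hθ₀c, hθ₀T, hne⟩ := hclock
      ((∫ x, ⟪U x, fderiv ℝ (fun x => fderiv ℝ g x a • c' - fderiv ℝ g x c' • a) x (U x)⟫) /
        ∫ x, ⟪U x, fderiv ℝ g x a • c' - fderiv ℝ g x c' • a⟫)
    obtain ⟨hE, -⟩ := Separable.momentum_separated hT₁ hdist hsep hθ₀ hθ₀c hθ₀T hη hdiv
    have hθ₀T0 : tsupport θ₀ ⊆ Iio 0 := hθ₀T.trans (Iio_subset_Iio hT₁)
    obtain ⟨hκ, hκc, -⟩ := AntiMember.deriv_cutoff_props hθ₀ hθ₀c hθ₀T0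
    have i1 : Integrable (fun t => deriv θ₀ t * Λ t) (volume : Measure ℝ) :=
      (hκ.mul hΛ).integrable_of_hasCompactSupport hκc.mul_right
    have i2 : Integrable (fun t => ((∫ x, ⟪U x, fderiv ℝ (fun x => fderiv ℝ g x a • c' - fderiv ℝ g x c' • a) x (U x)⟫) /
        ∫ x, ⟪U x, fderiv ℝ g x a • c' - fderiv ℝ g x c' • a⟫) * (θ₀ t * Λ t ^ 2)) (volume : Measure ℝ) :=
      ((hθ₀.continuous.mul (hΛ.pow 2)).integrable_of_hasCompactSupport hθ₀c.mul_right).const_mul _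
    apply hne
    rw [integral_add i1 i2, integral_const_mul]
    field_simp
    linear_combination hE

/-- **Binder language: NO SEPARABLE MEMBER WITH A NON-RICCATI CLOCK** (every `ρ > 0`): `u(t,x) = Λ(t)U(x)` a.e. on `(−∞,T₁) × ℝ³`, `Λ` continuous solving no
`Λ' = kΛ²` in `𝒟'((−∞,T₁))` (witnessed for each `k` by a test `θ` with `∫(θ'Λ + kθΛ²) ≠ 0`), `U` arbitrary ⇒ the member is trivial.  The Riccati clocks
`Λ = 1/(k(T*−t))` (stationary-profile collapse, `γ = 0`) and the constant clock are the only separable survivors. [folklore] -/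
theorem Birth.nonSelfSimilar_of_aeSeparableNonRiccatiPast :
    ∀ ρ : ℝ, 0 < ρ →
      ∀ (u : ℝ → EuclideanSpace ℝ (Fin 3) → EuclideanSpace ℝ (Fin 3)) (p : ℝ → EuclideanSpace ℝ (Fin 3) → ℝ)
        (H : ℝ → EuclideanSpace ℝ (Fin 3) → EuclideanSpace ℝ (Fin 3) →L[ℝ] EuclideanSpace ℝ (Fin 3)) (c : ℝ≥0),
        Birth.InClass ρ u p H c →
          (∃ T₁ : ℝ, T₁ ≤ 0 ∧ ∃ Λ : ℝ → ℝ, Continuous Λ ∧ ∃ U : EuclideanSpace ℝ (Fin 3) → EuclideanSpace ℝ (Fin 3),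
              (∀ᵐ z ∂(volume.restrict (Iio T₁ ×ˢ (univ : Set (EuclideanSpace ℝ (Fin 3))))), u z.1 z.2 = Λ z.1 • U z.2) ∧
              ∀ k : ℝ, ∃ θ : ℝ → ℝ, ContDiff ℝ ∞ θ ∧ HasCompactSupport θ ∧ tsupport θ ⊆ Iio T₁ ∧
                ∫ t, (deriv θ t * Λ t + k * (θ t * Λ t ^ 2)) ≠ 0) →
          uncurry u =ᵐ[volume.restrict (Iio (0 : ℝ) ×ˢ (univ : Set (EuclideanSpace ℝ (Fin 3))))] 0 := by
  intro ρ hρ u p H c hcl h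
  obtain ⟨T₁, hT₁, Λ, hΛ, U, hsep, hclock⟩ := h
  exact Loc.ae_eq_zero_of_aeSeparableNonRiccatiPast hρ hcl.1 hcl.2.1 hcl.2.2 hT₁ hΛ hsep hclock

end Summit.NavierStokesRegularity.NavierStokesRegularity.Theorems.PowerGaugeEulerLiouville

end
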